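import Literature.LinearAlgebra.Matrix.FrameConjugatedExponentialLoewner
import Literature.MathematicalPhysics.QuantumLattice.FermionConditionalFreeEnergyCertificate
import HarnessLib

/-!
# The conditional free-energy certificate from KEPT-FRAME witnesses: rational enclosures of `e^{−G}`,
# `e^{−G_W}` for `G = ḡ·1 + K diag(g − ḡ) Kᴴ` with a NEARLY orthonormal frame `K`

Topic `MathematicalPhysics/QuantumLattice`; companion of `FermionCondFreeEnergyCertificateEnclosure.lean`
(hubbard-thermal p2: the same passage for EXACTLY diagonalised witnesses `G = V diag(g) V*`, `V` unitary) and of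
`FermionConditionalFreeEnergyCertificate.lean` (`fermion_condFreeEnergy_le_of_certificate`:
`S(σ) − S(σ_{Λ∖a}) − Re tr(σ H) ≤ c` whenever `e^c·e^{L_B} − tr_{Λ→Λ∖a} e^{−H + Γ L_B} ⪰ 0`).

The thermal-SDP producers' «cent» rows with KEPT FRAMES (thermal_eeb ≥ 0.9.0, CERT-THERMAL §0.6) use
`H = G − Γ G_W`, `L_B = −G_W` with
`G = ḡ·1 + K diag(g − ḡ) Kᴴ ∈ 𝔄_Λ`, `G_W = ḡ_W·1 + K_W diag(u − ḡ_W) K_Wᴴ ∈ 𝔄_{Λ∖a}`, where `K`, `K_W` are the kept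
columns of floating-point eigen-decompositions rounded to dyadic rationals — only NEARLY orthonormal,
`‖KᴴK − 1‖ ≤ ε`. By `Literature.LinearAlgebra.Matrix.FrameExponential.cfc_exp_neg_shift_frameConj_loewner`
(`θ(α, ε) := e^{(1+ε)α} − (1+ε)e^{α} + ε`, `α ≥ ḡ − min g`):
`e^{−ḡ}(1 − θ)·1 + K diag(e^{−g_k} − e^{−ḡ}) Kᴴ ≤ e^{−G} ≤ e^{−ḡ}(1 + θ)·1 + K diag(e^{−g_k} − e^{−ḡ}) Kᴴ`.
Hence (this file, `fermion_condFreeEnergy_certificate_of_frameEnclosures`): if the producer supplies rational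
stand-ins `cI ≥ e^{−ḡ}(1 + θ)`, `cK_k ≥ e^{−g_k} − e^{−ḡ}` (upper, for `G`) and `cI_W ≤ e^{−ḡ_W}(1 − θ_W)`,
`cK_{W,k} ≤ e^{−u_k} − e^{−ḡ_W}` (lower, for `G_W`), `0 ≤ c_l ≤ e^c`, and the two EXACT semidefinite tests
`Z⁺ − tr_{Λ→Λ∖a}(cI·1 + K diag(cK) Kᴴ) ⪰ 0`, `c_l·(cI_W·1 + K_W diag(cK_W) K_Wᴴ) − Z⁺ ⪰ 0` pass, then the certificate
hypothesis of `fermion_condFreeEnergy_le_of_certificate` holds — so kept-frame «cent» rows are kernel-instantiable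
from rational data (`ε` from `ε² ≥ Σ|(KᴴK − 1)_{ij}|²`, `l2_opNorm_le_of_sum_sq_le`; scalar exponentials by the
`FixedPointExp` checks of `ThermalRowScalarChecks.lean`). Everything is PROVED; no definition, no named fact.

References: Poulin–Hastings 2011 eqs. (4)–(8) [PoulinHastings2011]; Kull et al. 2024 §5.3 (rounded, exactly checked
certificates) [KullEtAl2024]; Higham 2008 §10.1 [Higham2008].
-/

noncomputable section

namespace Literature.MathematicalPhysics.QuantumLattice

open Matrix Finset HubbardWave0 Literature.Probability.LatticeModels
open Literature.LinearAlgebra.Matrix.FrameExponential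
open scoped ComplexOrder Matrix.Norms.L2Operator MatrixOrder

variable {d : ℕ}

/-- `K diag(δ) Kᴴ ⪰ 0` for `δ ≥ 0` and ANY frame `K`. [cite: HornJohnson2013, Thm. 7.7.2(a)] -/
private theorem posSemidef_frameConj_diagonal {ι κ : Type*} [Fintype ι] [Fintype κ] [DecidableEq κ]
    (K : Matrix ι κ ℂ) {δ : κ → ℝ} (hδ : ∀ k, 0 ≤ δ k) :
    (K * diagonal (fun k => ((δ k : ℝ) : ℂ)) * Kᴴ).PosSemidef :=
  (Matrix.PosSemidef.diagonal (fun k => Complex.zero_le_real.2 (hδ k))).mul_mul_conjTranspose_same K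

/-- `(r·1 + K diag(p) Kᴴ) − (s·1 + K diag(q) Kᴴ) ⪰ 0` when `s ≤ r` and `q ≤ p` termwise.
[cite: HornJohnson2013, Thm. 7.7.2(a)] -/
private theorem posSemidef_shift_frameConj_sub {ι κ : Type*} [Fintype ι] [Fintype κ] [DecidableEq ι]
    [DecidableEq κ] (K : Matrix ι κ ℂ) {p q : κ → ℝ} {r s : ℝ} (hrs : s ≤ r) (hpq : ∀ k, q k ≤ p k) :
    ((((r : ℝ) : ℂ) • (1 : Matrix ι ι ℂ) + K * diagonal (fun k => ((p k : ℝ) : ℂ)) * Kᴴ) -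
      ((((s : ℝ) : ℂ)) • (1 : Matrix ι ι ℂ) + K * diagonal (fun k => ((q k : ℝ) : ℂ)) * Kᴴ)).PosSemidef := by
  have e : ((((r : ℝ) : ℂ) • (1 : Matrix ι ι ℂ) + K * diagonal (fun k => ((p k : ℝ) : ℂ)) * Kᴴ) -
      ((((s : ℝ) : ℂ)) • (1 : Matrix ι ι ℂ) + K * diagonal (fun k => ((q k : ℝ) : ℂ)) * Kᴴ)) =
      (((r - s : ℝ)) : ℂ) • (1 : Matrix ι ι ℂ) + K * diagonal (fun k => (((p k - q k : ℝ)) : ℂ)) * Kᴴ := by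
    have hd : K * diagonal (fun k => ((p k : ℝ) : ℂ)) * Kᴴ - K * diagonal (fun k => ((q k : ℝ) : ℂ)) * Kᴴ =
        K * diagonal (fun k => (((p k - q k : ℝ)) : ℂ)) * Kᴴ := by
      rw [← Matrix.sub_mul, ← Matrix.mul_sub, diagonal_sub]
      congr 2
      funext k
      push_cast
      ring
    rw [← hd]
    push_cast
    module
  rw [e]
  exact (PosSemidef.one.smul (Complex.zero_le_real.2 (sub_nonneg.2 hrs))).add
    (posSemidef_frameConj_diagonal K fun k => sub_nonneg.2 (hpq k))

/-- **The certificate from kept-frame enclosures.** Window witness `G = ḡ·1 + K diag(g − ḡ) Kᴴ ∈ 𝔄_Λ` and shield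
witness `G_W = ḡ_W·1 + K_W diag(u − ḡ_W) K_Wᴴ ∈ 𝔄_{Λ∖a}` with NEARLY orthonormal frames (`‖KᴴK − 1‖ ≤ ε`,
`‖K_WᴴK_W − 1‖ ≤ ε_W`, `ε, ε_W ≥ 0`), levels `g_k ≤ ḡ`, `ḡ − g_k ≤ α`, `u_k ≤ ḡ_W`, `ḡ_W − u_k ≤ α_W` (`α, α_W ≥ 0`),
`θ := e^{(1+ε)α} − (1+ε)e^{α} + ε` and `θ_W` likewise; rational stand-ins `cI ≥ e^{−ḡ}(1+θ)`,
`cK_k ≥ e^{−g_k} − e^{−ḡ}`, `cI_W ≤ e^{−ḡ_W}(1−θ_W)`, `cK_{W,k} ≤ e^{−u_k} − e^{−ḡ_W}`, `0 ≤ c_l ≤ e^c`; and the two exact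
semidefinite tests `Z⁺ − tr_{Λ→Λ∖a}(cI·1 + K diag(cK) Kᴴ) ⪰ 0`, `c_l·(cI_W·1 + K_W diag(cK_W) K_Wᴴ) − Z⁺ ⪰ 0`. Then
the dual certificate of `fermion_condFreeEnergy_le_of_certificate` holds for `H = G − Γ G_W`, `L_B = −G_W`:
`e^c·exp(−G_W) − tr_{Λ→Λ∖a} exp(−(G − Γ G_W) + Γ(−G_W)) ⪰ 0`. [cite: PoulinHastings2011, eqs. (4)–(8)]
[cite: KullEtAl2024, §5.3] [cite: Higham2008, §10.1] -/
theorem fermion_condFreeEnergy_certificate_of_frameEnclosures {Λ : Finset (Site d)} {a : Site d}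
    {ι ιW : Type*} [Fintype ι] [Fintype ιW] [DecidableEq ι] [DecidableEq ιW]
    {K : Matrix (Finset (Orb (PolySite Λ))) ι ℂ} {ε α gbar : ℝ} (hε : 0 ≤ ε) (hK : ‖Kᴴ * K - 1‖ ≤ ε)
    (hα : 0 ≤ α) {g : ι → ℝ} (hg : ∀ k, g k ≤ gbar) (hgα : ∀ k, gbar - g k ≤ α)
    {G : FermionOp Λ}
    (hG : G = (((gbar : ℝ)) : ℂ) • (1 : FermionOp Λ) + K * diagonal (fun k => ((g k - gbar : ℝ) : ℂ)) * Kᴴ)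
    {KW : Matrix (Finset (Orb (PolySite (Λ.erase a)))) ιW ℂ} {εW αW gbarW : ℝ} (hεW : 0 ≤ εW)
    (hKW : ‖KWᴴ * KW - 1‖ ≤ εW) (hαW : 0 ≤ αW) {u : ιW → ℝ} (hu : ∀ k, u k ≤ gbarW)
    (huα : ∀ k, gbarW - u k ≤ αW) {GW : FermionOp (Λ.erase a)}
    (hGW : GW = (((gbarW : ℝ)) : ℂ) • (1 : FermionOp (Λ.erase a)) +
      KW * diagonal (fun k => ((u k - gbarW : ℝ) : ℂ)) * KWᴴ)
    {cI : ℝ} (hcI : Real.exp (-gbar) * (1 + (Real.exp ((1 + ε) * α) - (1 + ε) * Real.exp α + ε)) ≤ cI)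
    {cK : ι → ℝ} (hcK : ∀ k, Real.exp (-g k) - Real.exp (-gbar) ≤ cK k)
    {cIW : ℝ} (hcIW : cIW ≤ Real.exp (-gbarW) * (1 - (Real.exp ((1 + εW) * αW) - (1 + εW) * Real.exp αW + εW)))
    {cKW : ιW → ℝ} (hcKW : ∀ k, cKW k ≤ Real.exp (-u k) - Real.exp (-gbarW))
    {c cl : ℝ} (hcl : cl ≤ Real.exp c) (hcl0 : 0 ≤ cl)
    {Zp : FermionOp (Λ.erase a)}
    (hZ : (Zp - fermionPartialTrace (PolySite.incl (Λ.erase_subset a))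
      ((((cI : ℝ)) : ℂ) • (1 : FermionOp Λ) + K * diagonal (fun k => ((cK k : ℝ) : ℂ)) * Kᴴ)).PosSemidef)
    (hcert : ((((cl : ℝ)) : ℂ) • ((((cIW : ℝ)) : ℂ) • (1 : FermionOp (Λ.erase a)) +
        KW * diagonal (fun k => ((cKW k : ℝ) : ℂ)) * KWᴴ) - Zp).PosSemidef) :
    ((Real.exp c : ℂ) • cfc Real.exp (-GW) -
      fermionPartialTrace (PolySite.incl (Λ.erase_subset a))
        (cfc Real.exp (-(G - fermionEmbed (PolySite.incl (Λ.erase_subset a)) GW) +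
          fermionEmbed (PolySite.incl (Λ.erase_subset a)) (-GW)))).PosSemidef := by
  -- the exponent is `−G`
  have hexp : -(G - fermionEmbed (PolySite.incl (Λ.erase_subset a)) GW) +
      fermionEmbed (PolySite.incl (Λ.erase_subset a)) (-GW) = -G := by
    rw [map_neg]
    abel
  rw [hexp]
  -- the two frame enclosures (upper for `e^{−G}`, lower for `e^{−G_W}`)
  obtain ⟨-, hGup⟩ := cfc_exp_neg_shift_frameConj_loewner hε hK hα hg hgα
  obtain ⟨hGWlo, -⟩ := cfc_exp_neg_shift_frameConj_loewner hεW hKW hαW hu huα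
  rw [← hG] at hGup
  rw [← hGW] at hGWlo
  -- names for the four matrices
  set θ : ℝ := Real.exp ((1 + ε) * α) - (1 + ε) * Real.exp α + ε with hθ
  set θW : ℝ := Real.exp ((1 + εW) * αW) - (1 + εW) * Real.exp αW + εW with hθW
  set Uex : FermionOp Λ := ((Real.exp (-gbar) * (1 + θ) : ℝ) : ℂ) • (1 : FermionOp Λ) +
    K * diagonal (fun k => ((Real.exp (-g k) - Real.exp (-gbar) : ℝ) : ℂ)) * Kᴴ with hUex
  set U : FermionOp Λ := (((cI : ℝ)) : ℂ) • (1 : FermionOp Λ) + K * diagonal (fun k => ((cK k : ℝ) : ℂ)) * Kᴴ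
    with hU
  set Lex : FermionOp (Λ.erase a) := ((Real.exp (-gbarW) * (1 - θW) : ℝ) : ℂ) • (1 : FermionOp (Λ.erase a)) +
    KW * diagonal (fun k => ((Real.exp (-u k) - Real.exp (-gbarW) : ℝ) : ℂ)) * KWᴴ with hLex
  set L : FermionOp (Λ.erase a) := (((cIW : ℝ)) : ℂ) • (1 : FermionOp (Λ.erase a)) +
    KW * diagonal (fun k => ((cKW k : ℝ) : ℂ)) * KWᴴ with hL
  -- piece 1: `e^c e^{−G_W} − c_l L ⪰ 0`
  have hexpW : (cfc Real.exp (-GW)).PosSemidef := by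
    rw [← Matrix.nonneg_iff_posSemidef]
    exact cfc_nonneg fun x _ => (Real.exp_pos x).le
  have hLle : (cfc Real.exp (-GW) - L).PosSemidef := by
    have h1 : (cfc Real.exp (-GW) - Lex).PosSemidef := Matrix.le_iff.1 hGWlo
    have h2 : (Lex - L).PosSemidef := posSemidef_shift_frameConj_sub KW hcIW hcKW
    simpa using h1.add h2
  have t1 : ((Real.exp c : ℂ) • cfc Real.exp (-GW) - (((cl : ℝ)) : ℂ) • L).PosSemidef := by
    have e : (Real.exp c : ℂ) • cfc Real.exp (-GW) - (((cl : ℝ)) : ℂ) • L =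
        (((Real.exp c - cl : ℝ)) : ℂ) • cfc Real.exp (-GW) + (((cl : ℝ)) : ℂ) • (cfc Real.exp (-GW) - L) := by
      push_cast
      module
    rw [e]
    exact (hexpW.smul (Complex.zero_le_real.2 (sub_nonneg.2 hcl))).add (hLle.smul (Complex.zero_le_real.2 hcl0))
  -- piece 4: `tr(U) − tr(e^{−G}) ⪰ 0`
  have hUge : (U - cfc Real.exp (-G)).PosSemidef := by
    have h1 : (Uex - cfc Real.exp (-G)).PosSemidef := Matrix.le_iff.1 hGup
    have h2 : (U - Uex).PosSemidef := posSemidef_shift_frameConj_sub K hcI hcK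
    simpa using h2.add h1
  have t4 : (fermionPartialTrace (PolySite.incl (Λ.erase_subset a)) U -
      fermionPartialTrace (PolySite.incl (Λ.erase_subset a)) (cfc Real.exp (-G))).PosSemidef := by
    rw [← map_sub]
    exact posSemidef_fermionPartialTrace _ hUge
  -- assemble
  have key := ((t1.add hcert).add hZ).add t4
  have heq : (Real.exp c : ℂ) • cfc Real.exp (-GW) -
      fermionPartialTrace (PolySite.incl (Λ.erase_subset a)) (cfc Real.exp (-G)) =
      ((Real.exp c : ℂ) • cfc Real.exp (-GW) - (((cl : ℝ)) : ℂ) • L) + ((((cl : ℝ)) : ℂ) • L - Zp) +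
        (Zp - fermionPartialTrace (PolySite.incl (Λ.erase_subset a)) U) +
        (fermionPartialTrace (PolySite.incl (Λ.erase_subset a)) U -
          fermionPartialTrace (PolySite.incl (Λ.erase_subset a)) (cfc Real.exp (-G))) := by
    abel
  rw [heq]
  exact key


/-- **The same certificate with the frame defects supplied as exact sums of squares** (`Σ_{ij} |(KᴴK − 1)_{ij}|² ≤ ε²`,
`Σ_{ij} |(K_WᴴK_W − 1)_{ij}|² ≤ ε_W²` — the checks a producer performs in rational arithmetic), via
`l2_opNorm_le_of_sum_sq_le`. [cite: PoulinHastings2011, eqs. (4)–(8)] [cite: KullEtAl2024, §5.3] -/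
theorem fermion_condFreeEnergy_certificate_of_frameEnclosures_of_sum_sq {Λ : Finset (Site d)} {a : Site d}
    {ι ιW : Type*} [Fintype ι] [Fintype ιW] [DecidableEq ι] [DecidableEq ιW]
    {K : Matrix (Finset (Orb (PolySite Λ))) ι ℂ} {ε α gbar : ℝ} (hε : 0 ≤ ε)
    (hK : ∑ i, ∑ j, ‖(Kᴴ * K - 1 : Matrix ι ι ℂ) i j‖ ^ 2 ≤ ε ^ 2)
    (hα : 0 ≤ α) {g : ι → ℝ} (hg : ∀ k, g k ≤ gbar) (hgα : ∀ k, gbar - g k ≤ α)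
    {G : FermionOp Λ}
    (hG : G = (((gbar : ℝ)) : ℂ) • (1 : FermionOp Λ) + K * diagonal (fun k => ((g k - gbar : ℝ) : ℂ)) * Kᴴ)
    {KW : Matrix (Finset (Orb (PolySite (Λ.erase a)))) ιW ℂ} {εW αW gbarW : ℝ} (hεW : 0 ≤ εW)
    (hKW : ∑ i, ∑ j, ‖(KWᴴ * KW - 1 : Matrix ιW ιW ℂ) i j‖ ^ 2 ≤ εW ^ 2) (hαW : 0 ≤ αW) {u : ιW → ℝ} (hu : ∀ k, u k ≤ gbarW)
    (huα : ∀ k, gbarW - u k ≤ αW) {GW : FermionOp (Λ.erase a)}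
    (hGW : GW = (((gbarW : ℝ)) : ℂ) • (1 : FermionOp (Λ.erase a)) +
      KW * diagonal (fun k => ((u k - gbarW : ℝ) : ℂ)) * KWᴴ)
    {cI : ℝ} (hcI : Real.exp (-gbar) * (1 + (Real.exp ((1 + ε) * α) - (1 + ε) * Real.exp α + ε)) ≤ cI)
    {cK : ι → ℝ} (hcK : ∀ k, Real.exp (-g k) - Real.exp (-gbar) ≤ cK k)
    {cIW : ℝ} (hcIW : cIW ≤ Real.exp (-gbarW) * (1 - (Real.exp ((1 + εW) * αW) - (1 + εW) * Real.exp αW + εW)))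
    {cKW : ιW → ℝ} (hcKW : ∀ k, cKW k ≤ Real.exp (-u k) - Real.exp (-gbarW))
    {c cl : ℝ} (hcl : cl ≤ Real.exp c) (hcl0 : 0 ≤ cl)
    {Zp : FermionOp (Λ.erase a)}
    (hZ : (Zp - fermionPartialTrace (PolySite.incl (Λ.erase_subset a))
      ((((cI : ℝ)) : ℂ) • (1 : FermionOp Λ) + K * diagonal (fun k => ((cK k : ℝ) : ℂ)) * Kᴴ)).PosSemidef)
    (hcert : ((((cl : ℝ)) : ℂ) • ((((cIW : ℝ)) : ℂ) • (1 : FermionOp (Λ.erase a)) +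
        KW * diagonal (fun k => ((cKW k : ℝ) : ℂ)) * KWᴴ) - Zp).PosSemidef) :
    ((Real.exp c : ℂ) • cfc Real.exp (-GW) -
      fermionPartialTrace (PolySite.incl (Λ.erase_subset a))
        (cfc Real.exp (-(G - fermionEmbed (PolySite.incl (Λ.erase_subset a)) GW) +
          fermionEmbed (PolySite.incl (Λ.erase_subset a)) (-GW)))).PosSemidef :=
  fermion_condFreeEnergy_certificate_of_frameEnclosures hε (l2_opNorm_le_of_sum_sq_le hε hK) hα hg hgα hG hεW
    (l2_opNorm_le_of_sum_sq_le hεW hKW) hαW hu huα hGW hcI hcK hcIW hcKW hcl hcl0 hZ hcert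

end Literature.MathematicalPhysics.QuantumLattice

end
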